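import Summits.BirchSwinnertonDyer.BirchSwinnertonDyer.Theorems.PrintCf2SplitBadTwoLocalControlKernelDichotomy
import Summits.BirchSwinnertonDyer.BirchSwinnertonDyer.Theorems.PrintCf2SplitBadTwoLocalControlKernelInertia
import Summits.BirchSwinnertonDyer.BirchSwinnertonDyer.Theorems.EisensteinPrimesIndexPlumbingNrVsStrict
import Literature.NumberTheory.EllipticCurves.Agboola2007.RestrictedSelmerDual
import Literature.NumberTheory.EllipticCurves.IwasawaSelmerControlCokerProofs
import Literature.NumberTheory.EllipticCurves.BigRepModuleShapiroSelmerConditionsProofs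
import Literature.NumberTheory.GaloisRepresentations.LocalGaloisGroupProofs
import HarnessLib

/-!
# Route C `PrintCf2RubinValueTwo` / road α skeleton v12, crux `RestrictedMainConjWithValueAtTwo` (stmt-BirchSwinnertonDyer-23722), (unr-INV) file 1 —
# GENERIC: the `Γ`-invariants of the UNRAMIFIED line group `H¹_{𝓕_nr}(K_∞, M)` are finite as soon as Agboola's `𝔖_v̄(K_∞, M)^Γ` and
# `M^{I_v̄}` are (any number field with complex infinite places, any `ℤ_p`-line, any discrete `p`-primary `M`)

Cell `bsd-print-cf2`, width seat `bsd-line-cf2c-w2` g2 (prover-bsd-line-cf2c-w2-g2-0); `--supports stmt-BirchSwinnertonDyer-23722` (helper; route-C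
twin of the LEAD's S3b′-v12 `stub_restrictedMainConj_two_v12`, whose conclusion quantifies over the Greenberg–Vatsal datum
`DatumDualData κ₂ γ₂ W* (bdpData W* 2 v̄) ∅` and asks `Module.Finite ∧ IsTorsion ∧ ch = (H) ∧ H(0) ≠ 0` of it — conjuncts that the push
(TW)+(RES)+(SP)+(VAL) does NOT produce, cf2c-w8 g2 2026-08-29T01:52Z; they follow from the finiteness of the `Γ`-invariants of the unramified
line group, proved here generically and in file 2 `…UnrSelmerInvariantsFinite` on the frames). HONEST FRAMING: nothing here closes the crux or a
registered stub; BSD is not proved by any of this; no summit statement is proved by this seat. No definition, no named fact, no `sorry`.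

THE ARGUMENT (NOT via the surjectivity `S_M(K_∞)/𝔖 ↠ ⊕_{𝔓 ∣ v̄} H¹_nr/H¹_str` of S3d — only an injection into ONE local group is used).
* §1 LOCAL `finite_subgroupResKer_kerSubgroup_inf_inertia` — `K` a number field, `κ` ANY `ℤ_p`-line, `M` discrete `p`-primary with open
  stabilisers, continuous orbits and finite `pⁿ`-torsion, `w` ANY finite place with `M^{I_w}` FINITE: the local classes at `w` that become
  UNRAMIFIED OVER THE LINE, `ker (H¹(D_w, M) → H¹(I_w ∩ Gal(K̄/K_∞), M))`, form a FINITE group — two inflation–restriction kernels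
  (`ResKernel.finite_subgroupResKer`): `D_w/I_w` is procyclic on a Frobenius (`exists_generator_decomp`) with `M^{I_w}` finite, and `I_w` is
  topologically generated by `I_w ∩ Gal(K̄/K_∞)` and ONE `τ` (`exists_topGenerator_of_continuous_padicInt` on the compact `I_w`,
  `I_w` closed) with `M^{I_w ∩ Gal(K̄/K_∞)}/(τ − 1)` finite by pigeonhole (`finite_quotient_range_of_finite_ker`: its kernel lies in `M^{I_w}`).
* §2 GLOBAL `finite_endInvariants_conjUnr_of_local` — a `γ`-invariant class of `unrSelmer κ M v̄ ∅` LIFTS to `H¹(K, M)` (Greenberg's Lemma 3.2,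
  `ZpExtension.mem_range_resOfLe_of_conjH1_eq` at layer `0`), hence is `Γ_K`-invariant, so Agboola's «at every conjugate» conditions collapse to
  the CHOSEN place: it lies in `𝔖_v̄(K_∞, M)` iff it dies on `Gal(K̄/K_∞) ⊓ D_v̄` (`strictKer_strictDatum_eq_awayKer`; `awayKer = unramifiedKer`
  at `w ∤ p` as hypothesis; complex places impose nothing). So `c ↦ res_{Gal(K̄/K_∞) ⊓ D_v̄} c` has kernel inside `𝔖^Γ` and image inside the
  restriction of the local kernel of §1 (the lift is unramified above `v̄` over the line, `IndexPlumbingNrVsStrict.resOfLe_conjH1_mem_subgroupResKer_of_mem_unrSelmer`).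
presearch: Greenberg LNM 1716 §3 Lemmas 3.1–3.3, §4 Lemma 4.2; Greenberg–Vatsal 2000 §2 (non-primitive Selmer groups); Agboola 2007 §3 Prop. 3.2 — all
held; assembly of tree theorems, no new fact. beyond-print theorem: no.

References: [GreenbergLNM1716] §3 Lemmas 3.1–3.3, §4 Lemma 4.2; [GreenbergVatsal2000] §2 pp. 17–21; [Agboola2007] §3 Prop. 3.2, §4;
[SerreGaloisCohomology1997] I §2.6; [NeukirchANT1999] Ch. II (9.6).
-/

noncomputable section

open scoped Classical
-- the summit namespace `Summit.BirchSwinnertonDyer.BirchSwinnertonDyer` repeats the problem name by design (D-0017)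
set_option linter.dupNamespace false
set_option autoImplicit false

open NumberField IsDedekindDomain Field WeierstrassCurve
open Literature.NumberTheory.EllipticCurves Literature.NumberTheory.EllipticCurves.GreenbergSelmer
open Literature.NumberTheory.EllipticCurves.GreenbergVatsal2000 Literature.NumberTheory.EllipticCurves.KellerYin2024
open Literature.NumberTheory.EllipticCurves.Agboola2007
open Literature.NumberTheory.EllipticCurves.IwasawaDual
open Literature.NumberTheory.EllipticCurves.ResKernel
open Literature.NumberTheory.GaloisRepresentations
open Summit.BirchSwinnertonDyer.BirchSwinnertonDyer.Theorems.PrintCf2.RestrictedSelmerPair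

namespace Summit.BirchSwinnertonDyer.BirchSwinnertonDyer.Theorems.PrintCf2.UnrInvariants

/-! ## §1. Local: `ker (H¹(D_w, M) → H¹(I_w ∩ Gal(K̄/K_∞), M))` is finite when `M^{I_w}` is finite -/

section Local

variable {K : Type} [Field K] [NumberField K] {p : ℕ} [Fact p.Prime] (κ : ZpExtension K p)
  (M : Type) [AddCommGroup M] [DistribMulAction (absoluteGaloisGroup K) M] [TopologicalSpace M] [DiscreteTopology M]
  (w : HeightOneSpectrum (𝓞 K))

/-- **THE LOCAL FINITENESS AT A PLACE WHERE THE LINE MAY RAMIFY.** `K` a number field, `κ` ANY `ℤ_p`-extension, `M` a discrete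
`p`-primary `Γ_K`-module with open stabilisers, continuous orbit maps and finite `pⁿ`-torsion levels, `w` ANY finite place with `M^{I_w}`
FINITE. Then, with `G₀ := κ⁻¹(ℤ_p) ⊓ D_w = D_w` and `I″ := Gal(K̄/K_∞) ⊓ I_w` (the inertia group of the line above `w`), the kernel
`ker (H¹(G₀, M) → H¹(I″, M))` — the local classes at `w` that become UNRAMIFIED over the line — is FINITE. Two inflation–restriction
steps (`ResKernel.finite_subgroupResKer`): `ker (H¹(D_w) → H¹(I_w)) ↪ M^{I_w}/(F − 1)` (`D_w/I_w` procyclic on a Frobenius `F`,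
`exists_generator_decomp`), and `ker (H¹(I_w) → H¹(I″)) ↪ M^{I″}/(τ − 1)` for a topological generator `τ` of `I_w` modulo `I″`
(`exists_topGenerator_of_continuous_padicInt` on the compact `I_w`), the latter finite by pigeonhole because `ker (τ − 1 | M^{I″}) ≤ M^{I_w}`.
[cite: GreenbergLNM1716, §3 Lemmas 3.1–3.3 (pp. 85–88)] [cite: SerreGaloisCohomology1997, I §2.6] -/
theorem finite_subgroupResKer_kerSubgroup_inf_inertia
    (hcont : ∀ m : M, Continuous fun g : absoluteGaloisGroup K ↦ g • m)
    (hstab : ∀ m : M, IsOpen (MulAction.stabilizer (absoluteGaloisGroup K) m : Set (absoluteGaloisGroup K)))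
    (hprim : ∀ m : M, ∃ k : ℕ, p ^ k • m = 0)
    (htors : ∀ n : ℕ, Finite (AddSubgroup.torsionBy M (p ^ n : ℕ)))
    [Finite (FixedPoints.addSubgroup (inertia w) M)] :
    Finite (subgroupResKer M ((κ.kerSubgroup ⊓ inertia w).subgroupOf (κ.layerSubgroup 0 ⊓ decomp w))) := by
  let G₀ : Subgroup (absoluteGaloisGroup K) := κ.layerSubgroup 0 ⊓ decomp w
  have hG₀D : G₀ ≤ decomp w := inf_le_right
  have hDG₀ : decomp w ≤ G₀ := fun g hg ↦ ⟨by rw [ZpExtension.layerSubgroup_zero]; trivial, hg⟩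
  have hIG₀ : inertia w ≤ G₀ := (inertia_le_decomp w).trans hDG₀
  let NI : Subgroup ↥G₀ := (inertia w).subgroupOf G₀
  let NI'' : Subgroup ↥G₀ := (κ.kerSubgroup ⊓ inertia w).subgroupOf G₀
  haveI hNI : NI.Normal := normal_inertia_subgroupOf w hG₀D
  have hcont₀ : ∀ m : M, Continuous fun g : ↥G₀ ↦ g • m := fun m ↦ (hcont m).comp continuous_subtype_val
  -- (i) `ker (H¹(G₀) → H¹(NI))` is finite
  obtain ⟨F, hgenF⟩ := exists_generator_decomp w hG₀D hDG₀
  have hfixI : FixedPoints.addSubgroup NI M = FixedPoints.addSubgroup (inertia w) M := by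
    ext m
    simp only [FixedPoints.mem_addSubgroup]
    constructor
    · intro h τ
      exact h ⟨⟨τ, hIG₀ τ.2⟩, Subgroup.mem_subgroupOf.mpr τ.2⟩
    · intro h x
      exact h ⟨((x : ↥G₀) : absoluteGaloisGroup K), Subgroup.mem_subgroupOf.mp x.2⟩
  haveI : Finite (FixedPoints.addSubgroup NI M) := by rw [hfixI]; infer_instance
  haveI : Finite (FixedPoints.addSubgroup NI M ⧸ (subOne NI M F).range) := inferInstance
  obtain ⟨hY₁, -⟩ := ResKernel.finite_subgroupResKer NI M F hgenF hcont₀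
  -- (ii) `↥NI` is compact and topologically generated by `N' := NI'' ⊓ NI` and one `τ`
  haveI : CompactSpace ↥G₀ := by
    haveI : CompactSpace (absoluteGaloisGroup (w.adicCompletion K)) := absoluteGaloisGroup_compactSpace _
    have hD : IsCompact ((decomp w : Subgroup (absoluteGaloisGroup K)) : Set (absoluteGaloisGroup K)) :=
      isCompact_range (absGaloisRestrict K (w.adicCompletion K)).continuous
    have hset : ((G₀ : Subgroup (absoluteGaloisGroup K)) : Set (absoluteGaloisGroup K)) =
        (decomp w : Set (absoluteGaloisGroup K)) :=
      Set.Subset.antisymm (fun g hg ↦ hG₀D hg) (fun g hg ↦ hDG₀ hg)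
    exact isCompact_iff_compactSpace.mp (hset ▸ hD)
  haveI : CompactSpace ↥NI := by
    have hcl : IsClosed ((NI : Subgroup ↥G₀) : Set ↥G₀) := by
      have hset : ((NI : Subgroup ↥G₀) : Set ↥G₀) = Subtype.val ⁻¹' (inertia w : Set (absoluteGaloisGroup K)) := by
        ext x
        simp only [SetLike.mem_coe, Set.mem_preimage, NI, Subgroup.mem_subgroupOf]
      rw [hset]
      -- `I_w` is closed in `Γ_K`: the image of the closed (compact) `absInertia K_w ≤ Γ_{K_w}` under the continuous restriction
      have hIcl : IsClosed ((inertia w : Subgroup (absoluteGaloisGroup K)) : Set (absoluteGaloisGroup K)) := by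
        haveI : CompactSpace (absoluteGaloisGroup (w.adicCompletion K)) := absoluteGaloisGroup_compactSpace _
        have hc : IsCompact ((absInertia (w.adicCompletion K) : Subgroup (absoluteGaloisGroup (w.adicCompletion K))) :
            Set (absoluteGaloisGroup (w.adicCompletion K))) :=
          (isClosed_absInertia_holds (w.adicCompletion K)).isCompact
        have himg := hc.image (absGaloisRestrict K (w.adicCompletion K)).continuous
        rw [GreenbergSelmer.inertia, Subgroup.coe_map]
        exact himg.isClosed
      exact hIcl.preimage continuous_subtype_val
    exact isCompact_iff_compactSpace.mp hcl.isCompact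
  let f : ↥NI →* Multiplicative ℤ_[p] := κ.toContinuousMonoidHom.toMonoidHom.comp (G₀.subtype.comp NI.subtype)
  have hf : Continuous f :=
    κ.toContinuousMonoidHom.continuous.comp (continuous_subtype_val.comp continuous_subtype_val)
  let N' : Subgroup ↥NI := NI''.subgroupOf NI
  have hker : f.ker = N' := by
    ext x
    simp only [MonoidHom.mem_ker, N', NI'', Subgroup.mem_subgroupOf, Subgroup.mem_inf, ZpExtension.mem_kerSubgroup, f,
      MonoidHom.coe_comp, Function.comp_apply, Subgroup.coe_subtype]
    exact ⟨fun h ↦ ⟨h, Subgroup.mem_subgroupOf.mp x.2⟩, fun h ↦ h.1⟩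
  obtain ⟨τ, hgenτ⟩ := exists_topGenerator_of_continuous_padicInt f hf
  have hgenτ' : ∀ U : Subgroup ↥NI, IsOpen (U : Set ↥NI) → N' ≤ U → τ ∈ U → U = ⊤ :=
    fun U hU hN hτ ↦ hgenτ U hU (hker.le.trans hN) hτ
  haveI hN' : N'.Normal := by
    refine ⟨fun n hn g ↦ ?_⟩
    have hn' : (((n : ↥NI) : ↥G₀) : absoluteGaloisGroup K) ∈ κ.kerSubgroup ⊓ inertia w :=
      Subgroup.mem_subgroupOf.mp (Subgroup.mem_subgroupOf.mp hn)
    have hg' : (((g : ↥NI) : ↥G₀) : absoluteGaloisGroup K) ∈ inertia w := Subgroup.mem_subgroupOf.mp g.2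
    refine Subgroup.mem_subgroupOf.mpr (Subgroup.mem_subgroupOf.mpr ?_)
    simp only [Subgroup.coe_mul, Subgroup.coe_inv]
    exact ⟨(inferInstance : κ.kerSubgroup.Normal).conj_mem _ hn'.1 _,
      (inertia w).mul_mem ((inertia w).mul_mem hg' hn'.2) ((inertia w).inv_mem hg')⟩
  have hcontI : ∀ m : M, Continuous fun g : ↥NI ↦ g • m :=
    fun m ↦ (hcont m).comp (continuous_subtype_val.comp continuous_subtype_val)
  -- the kernel of `τ − 1` on `M^{N'}` lies in `M^{I_w}`: finite
  haveI : Finite (subOne N' M τ).ker := by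
    refine Finite.of_injective (fun b : (subOne N' M τ).ker ↦
      (⟨((b : FixedPoints.addSubgroup N' M) : M), ?_⟩ : FixedPoints.addSubgroup (inertia w) M)) ?_
    · have hb0 : τ • ((b : FixedPoints.addSubgroup N' M) : M) = ((b : FixedPoints.addSubgroup N' M) : M) := by
        have h := congrArg (fun z : FixedPoints.addSubgroup N' M ↦ (z : M)) ((AddMonoidHom.mem_ker).mp b.2)
        simp only [coe_subOne_apply, ZeroMemClass.coe_zero] at h
        exact sub_eq_zero.mp h
      let U : Subgroup ↥NI :=
        (MulAction.stabilizer (absoluteGaloisGroup K) ((b : FixedPoints.addSubgroup N' M) : M)).comap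
          (G₀.subtype.comp NI.subtype)
      have hUo : IsOpen (U : Set ↥NI) := (hstab _).preimage (continuous_subtype_val.comp continuous_subtype_val)
      have hN'U : N' ≤ U := fun n hn ↦ by
        rw [Subgroup.mem_comap, MulAction.mem_stabilizer_iff]
        exact (b : FixedPoints.addSubgroup N' M).2 ⟨n, hn⟩
      have hτU : τ ∈ U := by
        rw [Subgroup.mem_comap, MulAction.mem_stabilizer_iff]
        exact hb0
      have hU := hgenτ' U hUo hN'U hτU
      intro i
      have hi : (⟨⟨(i : absoluteGaloisGroup K), hIG₀ i.2⟩, Subgroup.mem_subgroupOf.mpr i.2⟩ : ↥NI) ∈ U :=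
        hU ▸ Subgroup.mem_top _
      rw [Subgroup.mem_comap, MulAction.mem_stabilizer_iff] at hi
      exact hi
    · intro a b hab
      apply Subtype.ext
      apply Subtype.ext
      exact congrArg (fun z : FixedPoints.addSubgroup (inertia w) M ↦ (z : M)) hab
  haveI : Finite (FixedPoints.addSubgroup N' M ⧸ (subOne N' M τ).range) := by
    refine (finite_quotient_range_of_finite_ker (subOne N' M τ) (fun n ↦ AddSubgroup.torsionBy _ (p ^ n : ℕ))
      (fun m n hmn ↦ ?_) (fun b ↦ ?_) (fun n ↦ ?_) (fun n b hb ↦ ?_)).1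
    · intro b hb
      rw [AddSubgroup.torsionBy.nsmul_iff] at hb ⊢
      obtain ⟨c, hc⟩ := Nat.pow_dvd_pow p hmn
      rw [hc, Nat.mul_comm (p ^ m) c, ← smul_smul, hb, smul_zero]
    · obtain ⟨n, hn⟩ := hprim ((b : FixedPoints.addSubgroup N' M) : M)
      refine ⟨n, ?_⟩
      rw [AddSubgroup.torsionBy.nsmul_iff]
      exact Subtype.ext hn
    · haveI := htors n
      refine Finite.of_injective (fun b : AddSubgroup.torsionBy (FixedPoints.addSubgroup N' M) (p ^ n : ℕ) ↦
        (⟨((b : FixedPoints.addSubgroup N' M) : M), ?_⟩ : AddSubgroup.torsionBy M (p ^ n : ℕ))) ?_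
      · have hb := b.2
        rw [AddSubgroup.torsionBy.nsmul_iff] at hb ⊢
        exact congrArg (fun z : FixedPoints.addSubgroup N' M ↦ (z : M)) hb
      · intro a b hab
        apply Subtype.ext
        apply Subtype.ext
        exact congrArg (fun z : AddSubgroup.torsionBy M (p ^ n : ℕ) ↦ (z : M)) hab
    · rw [AddSubgroup.torsionBy.nsmul_iff] at hb ⊢
      rw [← map_nsmul, hb, map_zero]
  obtain ⟨hZ', -⟩ := ResKernel.finite_subgroupResKer N' M τ hgenτ' hcontI
  -- (iii) assemble: `Y ⊆ H¹(G₀, M)` maps to `H¹(NI, M)` with kernel in `Y₁` and image in `Z'`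
  let Y : AddSubgroup (discreteH1 ↥G₀ M) := subgroupResKer M NI''
  let ρ : ↥Y →+ subgroupH1 NI M := (resSubgroup NI M).comp Y.subtype
  haveI hkerρ : Finite ρ.ker := by
    haveI := hY₁
    refine Finite.of_injective (fun y : ρ.ker ↦ (⟨((y : ↥Y) : discreteH1 ↥G₀ M), ?_⟩ : subgroupResKer M NI)) ?_
    · exact (AddMonoidHom.mem_ker).mp y.2
    · intro a b hab
      apply Subtype.ext
      apply Subtype.ext
      exact congrArg (fun z : subgroupResKer M NI ↦ (z : discreteH1 ↥G₀ M)) hab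
  -- the comparison map `↥N' → ↥NI''`
  let j : ↥N' →ₜ* ↥NI'' :=
    { toFun := fun x ↦ ⟨((x : ↥NI) : ↥G₀), Subgroup.mem_subgroupOf.mp x.2⟩
      map_one' := rfl
      map_mul' := fun _ _ ↦ rfl
      continuous_toFun := (continuous_subtype_val.comp continuous_subtype_val).subtype_mk _ }
  have hcomp : (resSubgroup N' M).comp (resSubgroup NI M) =
      (resH1Hom j (AddMonoidHom.id M) (fun _ _ ↦ rfl)).comp (resSubgroup NI'' M) := by
    unfold ResKernel.resSubgroup
    rw [resH1Hom_comp, resH1Hom_comp]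
    exact resH1Hom_congr (ContinuousMonoidHom.ext fun _ ↦ rfl) (AddMonoidHom.ext fun _ ↦ rfl) _ _
  haveI hrangeρ : Finite ρ.range := by
    haveI := hZ'
    refine Finite.of_injective (fun r : ρ.range ↦ (⟨(r : subgroupH1 NI M), ?_⟩ : subgroupResKer M N')) ?_
    · obtain ⟨y, hy⟩ := r.2
      rw [mem_subgroupResKer_iff, ← hy]
      change ((resSubgroup N' M).comp (resSubgroup NI M)) ((y : ↥Y) : discreteH1 ↥G₀ M) = 0
      rw [hcomp, AddMonoidHom.comp_apply]
      have hy0 : resSubgroup NI'' M ((y : ↥Y) : discreteH1 ↥G₀ M) = 0 := (mem_subgroupResKer_iff _ _ _).mp y.2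
      rw [hy0, map_zero]
    · intro a b hab
      apply Subtype.ext
      exact congrArg (fun z : subgroupResKer M N' ↦ (z : subgroupH1 NI M)) hab
  haveI : Finite (↥Y ⧸ ρ.ker) := Finite.of_equiv _ (QuotientAddGroup.quotientKerEquivRange ρ).toEquiv.symm
  exact Finite.of_equiv _ (AddSubgroup.addGroupEquivQuotientProdAddSubgroup (s := ρ.ker)).symm

end Local

/-! ## §2. Global: `S_M(K_∞)^Γ` is finite when `𝔖^Γ` and the local kernel at `v̄` are -/

section Global

variable {K : Type} [Field K] [NumberField K] {p : ℕ} [Fact p.Prime] (κ : ZpExtension K p)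
  (M : Type) [AddCommGroup M] [DistribMulAction (absoluteGaloisGroup K) M] [TopologicalSpace M] [DiscreteTopology M]
  (vbar : HeightOneSpectrum (𝓞 K)) {γ : absoluteGaloisGroup K}

/-- **`H¹_{𝓕_nr}(K_∞, M)^Γ` IS FINITE when Agboola's `𝔖_v̄(K_∞, M)^Γ` and the local kernel `ker (H¹(D_v̄, M) → H¹(I_v̄ ∩ Gal(K̄/K_∞), M))`
are.** `K` a number field all of whose infinite places are complex, `κ` ANY `ℤ_p`-extension with topological generator `γ`, `M` discrete
`p`-primary with continuous orbit maps, `v̄ ∋ p`; assume that over the line «unramified = locally trivial» at every `w ∤ p`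
(`awayKer = unramifiedKer`, e.g. -w6 g4's `LineLocallyTrivial.awayKer_eq_unramifiedKer_of_frame`). A `γ`-invariant class `c` of the unramified
group `unrSelmer κ M v̄ ∅` (unramified at `w ∤ p` and above `v̄`, nothing at the other places over `p`) LIFTS to `H¹(K, M)` (Greenberg's Lemma 3.2,
`ZpExtension.mem_range_resOfLe_of_conjH1_eq` at layer `0`), hence is invariant under ALL of `Γ_K`, so every «for all conjugates» condition
collapses to the chosen place: `c ∈ 𝔖_v̄(K_∞, M)` iff `res_{Gal(K̄/K_∞) ⊓ D_v̄} c = 0` (`strictKer_strictDatum_eq_awayKer`, complex places impose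
nothing). So `c ↦ res_{Gal(K̄/K_∞) ⊓ D_v̄} c` has kernel inside `𝔖^Γ` and image inside the restriction of the local kernel (the lift of `c` is
unramified above `v̄` over the line). [cite: GreenbergLNM1716, §3 Lemmas 3.1–3.3, §4] [cite: GreenbergVatsal2000, §2 pp. 17–21]
[cite: Agboola2007, §3 Prop. 3.2] -/
theorem finite_endInvariants_conjUnr_of_local (hγ : κ.IsTopGenerator γ) (hvbar : ((p : ℕ) : 𝓞 K) ∈ vbar.asIdeal)
    (hcont : ∀ m : M, Continuous fun g : absoluteGaloisGroup K ↦ g • m)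
    (hprim : ∀ m : M, ∃ k : ℕ, p ^ k • m = 0)
    (hinf : ∀ w : InfinitePlace K, w.IsComplex)
    (haway : ∀ w : HeightOneSpectrum (𝓞 K), ((p : ℕ) : 𝓞 K) ∉ w.asIdeal →
      awayKer κ.kerSubgroup M w = unramifiedKer κ.kerSubgroup M w)
    (hloc : Finite (subgroupResKer M ((κ.kerSubgroup ⊓ inertia vbar).subgroupOf (κ.layerSubgroup 0 ⊓ decomp vbar))))
    (hS : Finite (endInvariants (conjRestricted κ M vbar γ - 1))) :
    Finite (endInvariants (conjUnr κ M vbar ∅ γ - 1)) := by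
  let H : Subgroup (absoluteGaloisGroup K) := κ.kerSubgroup
  let L0 : Subgroup (absoluteGaloisGroup K) := κ.layerSubgroup 0
  let G₀ : Subgroup (absoluteGaloisGroup K) := L0 ⊓ decomp vbar
  let S : AddSubgroup ↥(unrSelmer κ M vbar ∅) := endInvariants (conjUnr κ M vbar ∅ γ - 1)
  have hHL : H ≤ L0 := κ.kerSubgroup_le_layerSubgroup 0
  -- Step 1: `γ`-invariance and the lift to `H¹(K, M)`
  have hfixγ : ∀ s ∈ S, conjH1 H M γ ((s : ↥(unrSelmer κ M vbar ∅)) : subgroupH1 H M) = s := by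
    intro s hs
    have h := (mem_endInvariants_iff _ s).mp hs
    rw [IwasawaDual.End_sub_apply, AddMonoid.End.one_apply, sub_eq_zero] at h
    exact congrArg (fun z : ↥(unrSelmer κ M vbar ∅) ↦ (z : subgroupH1 H M)) h
  have hlift : ∀ s ∈ S, ∃ y : subgroupH1 L0 M,
      resOfLe M hHL y = ((s : ↥(unrSelmer κ M vbar ∅)) : subgroupH1 H M) := by
    intro s hs
    have h := ZpExtension.mem_range_resOfLe_of_conjH1_eq κ hγ 0 hcont hprim
      ((s : ↥(unrSelmer κ M vbar ∅)) : subgroupH1 H M) (by rw [pow_zero, pow_one]; exact hfixγ s hs)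
    exact h
  -- Step 2: `Γ_K`-invariance
  have hfixall : ∀ s ∈ S, ∀ σ : absoluteGaloisGroup K,
      conjH1 H M σ ((s : ↥(unrSelmer κ M vbar ∅)) : subgroupH1 H M) = s := by
    intro s hs σ
    obtain ⟨y, hy⟩ := hlift s hs
    rw [← hy]
    have h1 := congrArg (fun g ↦ g y) (resOfLe_comp_conjH1_holds (M := M) hHL σ)
    simp only [AddMonoidHom.comp_apply] at h1
    have hσ : σ ∈ L0 := by
      show σ ∈ κ.layerSubgroup 0
      rw [ZpExtension.layerSubgroup_zero]
      trivial
    rw [← h1, conjH1_of_mem_holds L0 M hσ, AddMonoidHom.id_apply]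
  -- Step 3: the map `f : S → H¹(H ⊓ D_v̄, M)`
  let f : ↥S →+ subgroupH1 (H ⊓ decomp vbar) M :=
    (resOfLe M (inf_le_left : H ⊓ decomp vbar ≤ H)).comp ((unrSelmer κ M vbar ∅).subtype.comp S.subtype)
  have hf : ∀ s : ↥S, f s = resOfLe M (inf_le_left : H ⊓ decomp vbar ≤ H)
      (((s : ↥S) : ↥(unrSelmer κ M vbar ∅)) : subgroupH1 H M) := fun _ ↦ rfl
  -- Step 4: `ker f ↪ 𝔖^Γ`
  haveI : Finite f.ker := by
    haveI := hS
    refine Finite.of_injective (fun s : f.ker ↦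
      (⟨⟨(((s : ↥S) : ↥(unrSelmer κ M vbar ∅)) : subgroupH1 H M), ?_⟩, ?_⟩ :
        endInvariants (conjRestricted κ M vbar γ - 1))) ?_
    · have hsS : ((s : ↥S) : ↥(unrSelmer κ M vbar ∅)) ∈ S := (s : ↥S).2
      have hsel := (((s : ↥S) : ↥(unrSelmer κ M vbar ∅))).2
      have hfix := hfixall _ hsS
      have hf0 : resOfLe M (inf_le_left : H ⊓ decomp vbar ≤ H)
          (((s : ↥S) : ↥(unrSelmer κ M vbar ∅)) : subgroupH1 H M) = 0 := by
        rw [← hf]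
        exact (AddMonoidHom.mem_ker).mp s.2
      rw [mem_restrictedSelmer_iff]
      refine ⟨fun w hw σ ↦ ?_, fun w σ ↦ ?_, fun σ ↦ ?_⟩
      · rw [hfix σ, haway w hw]
        have h := ((mem_datumSelmer_iff _).mp hsel).1
        have h' := (mem_unramifiedOutside_iff _).mp h w (Set.notMem_empty w) hw σ
        rwa [hfix σ] at h'
      · exact BigGaloisRep.mem_infKer_of_isComplex H M (hinf w) _
      · rw [hfix σ, BigGaloisRep.strictKer_strictDatum_eq_awayKer]
        exact (AddMonoidHom.mem_ker).mpr hf0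
    · rw [mem_endInvariants_iff, IwasawaDual.End_sub_apply, AddMonoid.End.one_apply, sub_eq_zero]
      exact Subtype.ext (hfixall _ (s : ↥S).2 γ)
    · intro a b hab
      apply Subtype.ext
      apply Subtype.ext
      apply Subtype.ext
      exact congrArg (fun z : endInvariants (conjRestricted κ M vbar γ - 1) ↦
        ((z : restrictedSelmerZp κ M vbar) : subgroupH1 H M)) hab
  -- Step 5: `range f` lies in the restriction of the local kernel
  haveI : Finite f.range := by
    haveI := hloc
    have hHDG₀ : H ⊓ decomp vbar ≤ G₀ := inf_le_inf_right _ hHL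
    let Y : AddSubgroup (subgroupH1 G₀ M) := subgroupResKer M ((H ⊓ inertia vbar).subgroupOf G₀)
    let T : Set (subgroupH1 (H ⊓ decomp vbar) M) := (resOfLe M hHDG₀) '' (Y : Set (subgroupH1 G₀ M))
    have hT : T.Finite := (Set.toFinite _).image _
    -- the comparison map `↥((H ⊓ I_v̄).subgroupOf G₀) → ↥((I_v̄).subgroupOf (H ⊓ D_v̄))`
    let j : ↥((H ⊓ inertia vbar).subgroupOf G₀) →ₜ* ↥((inertia vbar).subgroupOf (H ⊓ decomp vbar)) :=
      { toFun := fun x ↦ ⟨⟨((x : ↥G₀) : absoluteGaloisGroup K),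
            ⟨(Subgroup.mem_subgroupOf.mp x.2).1, (x : ↥G₀).2.2⟩⟩, Subgroup.mem_subgroupOf.mpr (Subgroup.mem_subgroupOf.mp x.2).2⟩
        map_one' := rfl
        map_mul' := fun _ _ ↦ rfl
        continuous_toFun := ((continuous_subtype_val.comp continuous_subtype_val).subtype_mk _).subtype_mk _ }
    have hcomp : resSubgroup ((H ⊓ inertia vbar).subgroupOf G₀) M =
        (resH1Hom j (AddMonoidHom.id M) (fun _ _ ↦ rfl)).comp
          ((resSubgroup ((inertia vbar).subgroupOf (H ⊓ decomp vbar)) M).comp (resOfLe M hHDG₀)) := by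
      unfold ResKernel.resSubgroup Literature.NumberTheory.EllipticCurves.resOfLe
      rw [resH1Hom_comp, resH1Hom_comp]
      exact resH1Hom_congr (ContinuousMonoidHom.ext fun _ ↦ rfl) (AddMonoidHom.ext fun _ ↦ rfl) _ _
    have hsub : (f.range : Set (subgroupH1 (H ⊓ decomp vbar) M)) ⊆ T := by
      rintro _ ⟨s, rfl⟩
      obtain ⟨y, hy⟩ := hlift _ (s : ↥S).2
      have hsel := (((s : ↥S) : ↥(unrSelmer κ M vbar ∅))).2
      refine ⟨resOfLe M (inf_le_left : G₀ ≤ L0) y, ?_, ?_⟩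
      · -- the lift is unramified above `v̄` over the line
        have hu := IndexPlumbingNrVsStrict.resOfLe_conjH1_mem_subgroupResKer_of_mem_unrSelmer κ vbar ∅ hvbar hsel 1
        rw [Literature.NumberTheory.EllipticCurves.conjH1_one_holds, AddMonoidHom.id_apply, ← hy] at hu
        have hyy : resOfLe M (inf_le_left : H ⊓ decomp vbar ≤ H) (resOfLe M hHL y) =
            resOfLe M hHDG₀ (resOfLe M (inf_le_left : G₀ ≤ L0) y) := by
          rw [← AddMonoidHom.comp_apply, Literature.NumberTheory.EllipticCurves.resOfLe_comp_holds, ← AddMonoidHom.comp_apply,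
            Literature.NumberTheory.EllipticCurves.resOfLe_comp_holds]
        rw [hyy, mem_subgroupResKer_iff] at hu
        show resOfLe M (inf_le_left : G₀ ≤ L0) y ∈ Y
        rw [mem_subgroupResKer_iff, hcomp, AddMonoidHom.comp_apply, AddMonoidHom.comp_apply, hu, map_zero]
      · rw [hf, ← hy, ← AddMonoidHom.comp_apply, Literature.NumberTheory.EllipticCurves.resOfLe_comp_holds,
          ← AddMonoidHom.comp_apply, Literature.NumberTheory.EllipticCurves.resOfLe_comp_holds]
    exact (hT.subset hsub).to_subtype
  -- Step 6: conclude
  haveI : Finite (↥S ⧸ f.ker) := Finite.of_equiv _ (QuotientAddGroup.quotientKerEquivRange f).toEquiv.symm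
  exact Finite.of_equiv _ (AddSubgroup.addGroupEquivQuotientProdAddSubgroup (s := f.ker)).symm

end Global

end Summit.BirchSwinnertonDyer.BirchSwinnertonDyer.Theorems.PrintCf2.UnrInvariants
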